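import Literature.Computability.AlgebraicComplexity.NilCoxeterTensor
import Literature.Computability.AlgebraicComplexity.StrassenMinimalBorderRank
import Literature.Computability.AlgebraicComplexity.SchoenhageTauBini
import HarnessLib

/-!
# `bR(T_{NC_n}) ≥ n! + 1` for `n ≥ 3`: the nil-Coxeter algebra is not of minimal border rank (Bläser–Lysikov 2016)

Topic `Literature/Computability/AlgebraicComplexity`; companion of `NilCoxeterTensor.lean`. Bläser–Lysikov
(MFCS 2016, arXiv:1606.04253; Thm. 2 with Lemma 13/Cor. 14 of the arXiv version: a unital algebra has minimal
border rank iff it is smoothable, and smoothable algebras are commutative) give `bR(A) ≥ dim A + 1` for every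
non-commutative unital algebra `A`; for `A = NC_n`, `n ≥ 3` (where `T_{s₀} T_{s₁} = T_{s₀s₁} ≠ T_{s₁s₀} =
T_{s₁} T_{s₀}`) this is the lower frame `bR(T_{NC_n}) ≥ n! + 1` quoted by route
`MatrixMultiplication/NilCoxeterShadow`. Here it is PROVED for the tree's algebraic border rank over `K[ε]`
(`K` any domain) by the elementary route through **Strassen's equations for minimal border rank**
(`StrassenMinimalBorderRank.lean`: an order-`h` approximate decomposition with exactly `m = dim` triads forces
`X(p) adj X(p') X(p'') = X(p'') adj X(p') X(p)` for the slices): rotating `T_{NC_n}` to `(x; y, z)` and relabelling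
`S_n` by `Fin n!`, the slices are the (transposed) left multiplications `L_x`, `L_1 = 1`, and the identity at
`(p, p', p'') = (s₀, 1, s₁)` evaluated at the entry `(1, s₁s₀)` reads `[s₁s₀ = s₁s₀ reduced] = [s₁s₀ = s₀s₁]`, i.e.
`1 = 0`.

## Contents (all proved; no definitions, no named facts)

* `fin_val_facts`, `val_swap_one_two_mul_swap_zero_one_apply`, `inversionNumber_swap_one_two_mul_swap_zero_one` — `inv(s₁ s₀) = 2` in `S_{k+3}` (its inversions are `(0,1), (0,2)`).
* `not_isApproxDecomposition_card_nilCoxeterTensor` — no approximate decomposition of `T_{NC_{k+3}}` with exactly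
  `(k+3)!` (= `Fintype.card`) triads, over a domain.
* `factorial_succ_le_approxRank_nilCoxeterTensor`, `factorial_succ_le_algBorderRank_nilCoxeterTensor` —
  **`n! + 1 ≤ R_h(T_{NC_n})` and `n! + 1 ≤ bR(T_{NC_n})` for `3 ≤ n`**, `K` any domain.

## References

* [BlaserLysikov2016] M. Bläser, V. Lysikov, *On degeneration of tensors and algebras*, MFCS 2016, LIPIcs 58,
  19:1–19:11 = arXiv:1606.04253 — §3 (algebras of minimal border rank are smoothable; smoothable ⟹ commutative).
* [Landsberg2017] J. M. Landsberg, *Geometry and Complexity Theory*, CUP 2017 — Prop. 2.2.1.3, §2.4.1 (Strassen's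
  equations, adjugate form), the tool formalised in `StrassenMinimalBorderRank.lean`.
* [Blaser2013] M. Bläser, *Fast Matrix Multiplication*, Theory of Computing Graduate Surveys 5 (2013), Def. 6.1.
-/

noncomputable section

open scoped BigOperators Polynomial Matrix
open Polynomial Matrix

namespace Literature.Computability.AlgebraicComplexity

universe u

/-! ## The two generators `s₀ = (0 1)`, `s₁ = (1 2)` of `S_{k+3}` do not commute, and `inv(s₁s₀) = 2` -/

section Perm

variable {k : ℕ}

/-- `0, 1, 2` are distinct in `Fin (k+3)` (as values). [folklore] -/
theorem fin_val_facts : ((0 : Fin (k + 3)) : ℕ) = 0 ∧ ((1 : Fin (k + 3)) : ℕ) = 1 ∧ ((2 : Fin (k + 3)) : ℕ) = 2 :=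
  ⟨Fin.val_zero _, Fin.val_one _, Fin.val_two⟩

/-- Values of `s₁ s₀ = (1 2)(0 1)`: `0 ↦ 2`, `1 ↦ 0`, `2 ↦ 1`, fixed elsewhere. [folklore] -/
theorem val_swap_one_two_mul_swap_zero_one_apply (t : Fin (k + 3)) :
    (((Equiv.swap (1 : Fin (k + 3)) 2 * Equiv.swap 0 1 : Equiv.Perm (Fin (k + 3))) t : Fin (k + 3)) : ℕ) =
      if (t : ℕ) = 0 then 2 else if (t : ℕ) = 1 then 0 else if (t : ℕ) = 2 then 1 else (t : ℕ) := by
  obtain ⟨h0, h1, h2⟩ := (fin_val_facts (k := k))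
  have h01 : (0 : Fin (k + 3)) ≠ 1 := fun h => by have := congrArg Fin.val h; omega
  have h02 : (0 : Fin (k + 3)) ≠ 2 := fun h => by have := congrArg Fin.val h; omega
  have h12 : (1 : Fin (k + 3)) ≠ 2 := fun h => by have := congrArg Fin.val h; omega
  rw [Equiv.Perm.mul_apply]
  by_cases ht0 : t = 0
  · subst ht0
    rw [Equiv.swap_apply_left, Equiv.swap_apply_left, h2, h0]
    simp
  by_cases ht1 : t = 1
  · subst ht1
    rw [Equiv.swap_apply_right, Equiv.swap_apply_of_ne_of_ne h01 h02, h0, h1]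
    simp
  by_cases ht2 : t = 2
  · subst ht2
    rw [Equiv.swap_apply_of_ne_of_ne h02.symm h12.symm, Equiv.swap_apply_right, h1, h2]
    simp
  have ht0' : (t : ℕ) ≠ 0 := fun h => ht0 (Fin.ext (by rw [h0]; exact h))
  have ht1' : (t : ℕ) ≠ 1 := fun h => ht1 (Fin.ext (by rw [h1]; exact h))
  have ht2' : (t : ℕ) ≠ 2 := fun h => ht2 (Fin.ext (by rw [h2]; exact h))
  rw [Equiv.swap_apply_of_ne_of_ne ht0 ht1, Equiv.swap_apply_of_ne_of_ne ht1 ht2, if_neg ht0', if_neg ht1',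
    if_neg ht2']

/-- **`inv(s₁ s₀) = 2`**: the inversions of `(1 2)(0 1) = [2, 0, 1, 3, …]` are exactly `(0,1)` and `(0,2)`.
[cite: BjornerBrenti2005, §1.5, (1.25)] -/
theorem inversionNumber_swap_one_two_mul_swap_zero_one :
    inversionNumber (Equiv.swap (1 : Fin (k + 3)) 2 * Equiv.swap 0 1) = 2 := by
  obtain ⟨h0, h1, h2⟩ := (fin_val_facts (k := k))
  rw [inversionNumber, Finset.card_eq_two]
  refine ⟨((0 : Fin (k + 3)), (1 : Fin (k + 3))), ((0 : Fin (k + 3)), (2 : Fin (k + 3))), ?_, ?_⟩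
  · intro h
    have h' := congrArg (fun q : Fin (k + 3) × Fin (k + 3) => (q.2 : ℕ)) h
    simp only [h1, h2] at h'
    omega
  · ext p
    obtain ⟨a, b⟩ := p
    have ha := a.isLt
    have hb := b.isLt
    rw [mem_filter_inversion_iff, Finset.mem_insert, Finset.mem_singleton, Prod.mk.injEq, Prod.mk.injEq,
      Fin.lt_def, Fin.lt_def, val_swap_one_two_mul_swap_zero_one_apply,
      val_swap_one_two_mul_swap_zero_one_apply, Fin.ext_iff, Fin.ext_iff, Fin.ext_iff, h0, h1, h2]
    dsimp only
    constructor
    · intro h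
      obtain ⟨hab, hlt⟩ := h
      split_ifs at hlt <;> omega
    · intro h
      refine ⟨by omega, ?_⟩
      split_ifs <;> omega

/-- `inv(s₀) = 1` for `s₀ = (0 1)`. [cite: BjornerBrenti2005, §1.5, (1.26)] -/
theorem inversionNumber_swap_zero_one : inversionNumber (Equiv.swap (0 : Fin (k + 3)) 1) = 1 := by
  have h := inversionNumber_swap_castSucc_succ (n := k + 2) 0
  rwa [Fin.castSucc_zero, Fin.succ_zero_eq_one] at h

/-- `inv(s₁) = 1` for `s₁ = (1 2)`. [cite: BjornerBrenti2005, §1.5, (1.26)] -/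
theorem inversionNumber_swap_one_two : inversionNumber (Equiv.swap (1 : Fin (k + 3)) 2) = 1 := by
  have h := inversionNumber_swap_castSucc_succ (n := k + 2) 1
  rwa [Fin.castSucc_one, Fin.succ_one_eq_two] at h

/-- `s₀ s₁ ≠ s₁ s₀` (they send `0` to `1` and to `2` respectively). [folklore] -/
theorem swap_zero_one_mul_swap_one_two_ne :
    Equiv.swap (0 : Fin (k + 3)) 1 * Equiv.swap 1 2 ≠ Equiv.swap (1 : Fin (k + 3)) 2 * Equiv.swap 0 1 := by
  intro h
  have h0 := Equiv.ext_iff.1 h 0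
  rw [Equiv.Perm.mul_apply, Equiv.Perm.mul_apply] at h0
  obtain ⟨hv0, hv1, hv2⟩ := (fin_val_facts (k := k))
  have h01 : (0 : Fin (k + 3)) ≠ 1 := fun h' => by have := congrArg Fin.val h'; omega
  have h02 : (0 : Fin (k + 3)) ≠ 2 := fun h' => by have := congrArg Fin.val h'; omega
  have h12 : (1 : Fin (k + 3)) ≠ 2 := fun h' => by have := congrArg Fin.val h'; omega
  rw [Equiv.swap_apply_of_ne_of_ne h01 h02, Equiv.swap_apply_left, Equiv.swap_apply_left] at h0
  exact h12 h0

end Perm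

/-! ## Strassen's equations exclude minimal border rank for `T_{NC_n}`, `n ≥ 3` -/

section LowerBound

variable (K : Type u) [CommRing K] [IsDomain K]

/-- **No approximate decomposition of `T_{NC_{k+3}}` has exactly `(k+3)!` triads** (`K` a domain). Rotate to
`(x; y, z)`, relabel both matrix slots by `e : Fin (k+3)! ≃ S_{k+3}`; the slices are `M(x)_{ij} = T(e j; x, e i)`
with `M(1) = 1`, Strassen's identity gives `M(s₀) M(s₁) = M(s₁) M(s₀)`, and the entry `(e⁻¹ 1, e⁻¹(s₁s₀))` of
`M(x) M(y)` is `T(s₁s₀; y, x)`: `[inv(s₁s₀) = 2] = 1` on the left, `[s₀s₁ = s₁s₀] = 0` on the right.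
[cite: BlaserLysikov2016, §3] [cite: Landsberg2017, Prop. 2.2.1.3 and §2.4.1] -/
theorem not_isApproxDecomposition_card_nilCoxeterTensor {k h : ℕ}
    {u v w : Fin (Fintype.card (Equiv.Perm (Fin (k + 3)))) → Equiv.Perm (Fin (k + 3)) → K[X]}
    (hd : IsApproxDecomposition h (nilCoxeterTensor K (k + 3)) u v w) : False := by
  set e : Fin (Fintype.card (Equiv.Perm (Fin (k + 3)))) ≃ Equiv.Perm (Fin (k + 3)) :=
    (Fintype.equivFin (Equiv.Perm (Fin (k + 3)))).symm with he
  set a : Equiv.Perm (Fin (k + 3)) := Equiv.swap 0 1 with ha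
  set b : Equiv.Perm (Fin (k + 3)) := Equiv.swap 1 2 with hb
  -- rotate to `(x; y, z)` and relabel the two matrix slots by `e`
  have hd' := (isApproxDecomposition_rotate hd).precomp id e e
  have hS := slice_mul_adjugate_mul_comm_of_isApproxDecomposition hd' a 1 b
  set M : Equiv.Perm (Fin (k + 3)) →
      Matrix (Fin (Fintype.card (Equiv.Perm (Fin (k + 3))))) (Fin (Fintype.card (Equiv.Perm (Fin (k + 3))))) K :=
    fun x => Matrix.of ((fun x' i j => rotate (nilCoxeterTensor K (k + 3)) (id x') (e i) (e j)) x) with hM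
  change M a * adjugate (M 1) * M b = M b * adjugate (M 1) * M a at hS
  -- the unit slice is the identity matrix
  have hone : M 1 = 1 := by
    ext i j
    simp only [hM, Matrix.of_apply, rotate_apply, id, nilCoxeterTensor_one_left, Matrix.one_apply,
      e.apply_eq_iff_eq]
  rw [hone, adjugate_one, mul_one, mul_one] at hS
  -- entries of `M x * M y` in the row of the identity
  have hentry : ∀ x y z : Equiv.Perm (Fin (k + 3)),
      (M x * M y) (e.symm 1) (e.symm z) = nilCoxeterTensor K (k + 3) z y x := by
    intro x y z
    rw [Matrix.mul_apply]
    simp only [hM, Matrix.of_apply, rotate_apply, id, Equiv.apply_symm_apply, nilCoxeterTensor_one_right]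
    rw [e.sum_comp (fun t => (if x = t then (1 : K) else 0) * nilCoxeterTensor K (k + 3) z y t)]
    simp only [ite_mul, one_mul, zero_mul, Finset.sum_ite_eq, Finset.mem_univ, if_true]
  have h1 := congrFun (congrFun hS (e.symm 1)) (e.symm (b * a))
  rw [hentry a b (b * a), hentry b a (b * a), nilCoxeterTensor_apply_mul,
    nilCoxeterTensor_apply_of_ne (by rw [ha, hb]; exact swap_zero_one_mul_swap_one_two_ne),
    inversionNumber_swap_one_two_mul_swap_zero_one, inversionNumber_swap_one_two,
    inversionNumber_swap_zero_one] at h1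
  exact one_ne_zero h1

/-- **`R_h(T_{NC_n}) ≥ n! + 1` for every order `h`**, `3 ≤ n`, `K` a domain: a decomposition with `≤ n!` triads,
padded to exactly `n! = |S_n|` triads, would contradict `not_isApproxDecomposition_card_nilCoxeterTensor`.
[cite: BlaserLysikov2016, §3] -/
theorem factorial_succ_le_approxRank_nilCoxeterTensor {n : ℕ} (hn : 3 ≤ n) (h : ℕ) :
    n.factorial + 1 ≤ approxRank h (nilCoxeterTensor K n) := by
  obtain ⟨k, rfl⟩ : ∃ k, n = k + 3 := ⟨n - 3, by omega⟩
  by_contra hlt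
  have hle : approxRank h (nilCoxeterTensor K (k + 3)) ≤ Fintype.card (Equiv.Perm (Fin (k + 3))) := by
    rw [Fintype.card_perm, Fintype.card_fin]
    omega
  obtain ⟨u, v, w, hd⟩ := exists_isApproxDecomposition_of_approxRank_le hle
  exact not_isApproxDecomposition_card_nilCoxeterTensor K hd

/-- **Bläser–Lysikov: `bR(T_{NC_n}) ≥ n! + 1` for `n ≥ 3`** (algebraic border rank over `K[ε]`, `K` any domain):
the nil-Coxeter algebra `NC_n` is unital and non-commutative, hence not of minimal border rank `n! = dim NC_n`.
[cite: BlaserLysikov2016, §3] [cite: Landsberg2017, Prop. 2.2.1.3] -/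
theorem factorial_succ_le_algBorderRank_nilCoxeterTensor {n : ℕ} (hn : 3 ≤ n) :
    n.factorial + 1 ≤ algBorderRank (nilCoxeterTensor K n) :=
  le_ciInf fun h => factorial_succ_le_approxRank_nilCoxeterTensor K hn h

end LowerBound

end Literature.Computability.AlgebraicComplexity

end
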